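import Summits.ResolutionOfSingularities.ResolutionOfSingularities.Theorems.FrobeniusClosingSteerHullVocabulary
import Summits.ResolutionOfSingularities.ResolutionOfSingularities.Theorems.FrobeniusClosingSteerCore4LowMultTwoCore
import Mathlib.Algebra.BigOperators.Associated
import HarnessLib

/-!
# Crux `Steer` (stmt-ResolutionOfSingularities-16345), chain W4.1 — **PERSISTENT EXCEPTIONAL DIVISORS ARE FINITELY MANY**
# (Heinzer–Loper–Olberding–Schoutens–Toeniskoetter, arXiv:1505.06445, Prop. 2.8, made elementary along the valuation)

OURS (campaign `res-hironaka`, rung L ★L-G4, slot W4.1; seat res-type-028 on res-L0-w41-plan-1 RULING 69a «discharge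
`HeinzerEtAl2015HullParameterExists` first», milestone «finitely many eternal births»; NOT a statement of the manuscript under
review [claim: Hironaka2017, status: under-review]; AI-produced, weaker than expert review).  Theses-free, definition-free.

SETTING.  `R 0 ⊆ R 1 ⊆ ⋯ ⊆ O` a sequence of quadratic transforms of regular local subrings of a field `K` along the valuation
ring `O` (every member dominated by `O`), and EXCEPTIONAL PARAMETERS `x j ∈ R j`: `x j ≠ 0`, of positive value, with
`𝔪_j ⊆ x_j · R (j+1)` (every element of `R j` of positive value is divisible by `x j` in `R (j+1)`).  Such `x j` exist
(`exists_excParam`: the generator of minimal value of `IsQuadraticTransformAlong.exists_eq_locAtCentre`; it is moreover a regular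
parameter of `R j`).

THE DIVISIBILITY BOOKKEEPING (no strict transforms, no order valuations).  For `k < k' < j`, `x k'` DIVIDES `x k` in `R j`
(`div_excParam_mem`).  Call the index `k` DEAD AT STAGE `j` if `x k` divides a power of `x (k+1)` in `R j` (all the prime factors of
`x k` in the regular local ring `R j` — the exceptional prime divisors created at stages `≥ k` still passing through the centre of
`R j` — already divide `x (k+1)`), and ETERNAL if it is dead at no stage (`k`'s own exceptional divisor passes through every later
centre).  **`card_eternal_le`**: a finite set of eternal indices below `j − 1` has at most `s` elements whenever `x 0` is a
monomial × unit on an `s`-element part of a regular system of parameters of `R j` — which holds at EVERY stage with `s ≤ dim R j`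
(`exists_monomial_along` ∘ `stub_rsopMonomialStep`, HLOST Lemma 2.7; `card_eternal_le_ringKrullDim`): the divisors `x k`, `x (k+1)`
of `x 0` are monomials × units on the same part (`exists_monomial_of_mul_eq`); an eternal `k` owns a parameter `z l_k` dividing
`x k` but not `x (k+1)` (`pow_div_mem_of_support_subset`), and `k ↦ l_k` is injective since `x k' ∣ x (k+1)` for `k < k'`.  With a
uniform dimension bound this is HLOST Prop. 2.8 («`epd(S/R)` contains at most `dim R − 1` of the order valuation rings»; here
`≤ dim`, all the hull-parameter existence needs).  The COMPANION file `…SteerHullParameter.lean` turns «finitely many eternal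
indices» (`pow_div_mem_shannonExt_of_dead`) into HLOST Prop. 3.8 (`HeinzerEtAl2015HullParameterExists_holds`).

Sources: [HeinzerEtAl2015] Lemma 2.7, Prop. 2.8, Prop. 3.8; [Cutkosky2014] §2.2.  No named facts, no `sorry`.
-/

noncomputable section

-- `Summit.<S>.<S>.…` duplicates the summit name by design (single-problem summit).
set_option linter.dupNamespace false
set_option autoImplicit false

namespace Summit.ResolutionOfSingularities.ResolutionOfSingularities.Theorems.SwitchingDichotomy.Hull

open IsLocalRing
open Literature.AlgebraicGeometry.Resolution
open Summit.ResolutionOfSingularities.ResolutionOfSingularities.Theorems.SwitchingDichotomy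
  (exists_monomial_along exists_monomial_of_mul_eq stub_rsopMonomialStep)
open Summit.ResolutionOfSingularities.ResolutionOfSingularities.Theorems.SwitchingDichotomy.LowMult
  (isRsopPart_one_of_not_mem_sq)

variable {K : Type} [Field K]

/-! ## Exceptional parameters -/

/-- In a local subring `R ⊆ O` dominated by `O`, an element of `𝔪_R²` has value strictly below the value of any nonzero
element `x ∈ 𝔪_R` of maximal value in `𝔪_R` (i.e. minimal valuation): `v(ab) = v(a) v(b) ≤ v(x)² < v(x)`. [folklore] -/
theorem valuation_lt_of_mem_sq {O : ValuationSubring K} {R : Subring K} [IsLocalRing R]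
    (hdom : SubringDominates R O.toSubring) {x : R} (hx0 : x ≠ 0) (hxm : x ∈ maximalIdeal R)
    (hmax : ∀ y ∈ maximalIdeal R, O.valuation (y : K) ≤ O.valuation (x : K))
    {y : R} (hy : y ∈ maximalIdeal R ^ 2) : O.valuation (y : K) < O.valuation (x : K) := by
  have hRO : R ≤ O.toSubring := hdom.1
  have hvx : O.valuation (x : K) < 1 := ((subringDominates_valuationSubring_iff hRO).mp hdom x).mp hxm
  have hvx0 : 0 < O.valuation (x : K) := (Valuation.pos_iff _).mpr (fun h => hx0 (Subtype.ext h))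
  -- the bound `v(y) ≤ v(x)^2` holds on `𝔪²` (closed under the generators `a*b` and sums)
  have key : ∀ y ∈ maximalIdeal R ^ 2, O.valuation (y : K) ≤ O.valuation (x : K) ^ 2 := by
    intro y hy
    rw [pow_two] at hy
    refine Submodule.mul_induction_on hy (fun a ha b hb => ?_) (fun a b ha hb => ?_)
    · rw [Subring.coe_mul, map_mul, pow_two]
      exact mul_le_mul' (hmax a ha) (hmax b hb)
    · rw [Subring.coe_add]
      exact (Valuation.map_add _ _ _).trans (max_le ha hb)
  calc O.valuation (y : K) ≤ O.valuation (x : K) ^ 2 := key y hy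
    _ < O.valuation (x : K) := by
        rw [pow_two]
        exact mul_lt_of_lt_one_left hvx0 hvx

/-- **Exceptional parameters exist at every step.** For a quadratic transform `R → R₁` along `O` of a regular local ring
dominated by `O` there is `x ∈ R`, nonzero of positive value, a one-element part of a regular system of parameters of `R`, such
that every element of `R` of positive value is divisible by `x` in `R₁` (`𝔪_R ⊆ x R₁`, i.e. `𝔪_R R₁ = x R₁`): the generator of
minimal value. [cite: HeinzerEtAl2015, Lemma 2.7] [folklore] -/
theorem exists_excParam {O : ValuationSubring K} {R R₁ : Subring K} [IsRegularLocalRing R]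
    (hdom : SubringDominates R O.toSubring) (h : IsQuadraticTransformAlong O R R₁) :
    ∃ x : K, ∃ hxR : x ∈ R, x ≠ 0 ∧ O.valuation x < 1 ∧ IsRsopPart (fun _ : Fin 1 => (⟨x, hxR⟩ : R)) ∧
      ∀ y : K, y ∈ R → O.valuation y < 1 → y / x ∈ R₁ := by
  classical
  have hRO : R ≤ O.toSubring := hdom.1
  obtain ⟨_, x, hxm, hx0, hmax, hR₁⟩ := h.exists_eq_locAtCentre
  have hvx : O.valuation (x : K) < 1 := ((subringDominates_valuationSubring_iff hRO).mp hdom x).mp hxm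
  have hx2 : x ∉ maximalIdeal R ^ 2 := fun h2 => lt_irrefl _ (valuation_lt_of_mem_sq hdom hx0 hxm hmax h2)
  refine ⟨(x : K), x.2, fun h0 => hx0 (Subtype.ext h0), hvx, ?_, fun y hy hvy => ?_⟩
  · have : (⟨(x : K), x.2⟩ : R) = x := Subtype.ext rfl
    rw [this]
    exact isRsopPart_one_of_not_mem_sq hxm hx2
  · have hym : (⟨y, hy⟩ : R) ∈ maximalIdeal R :=
      ((subringDominates_valuationSubring_iff hRO).mp hdom ⟨y, hy⟩).mpr hvy
    rw [hR₁]
    exact le_locAtCentre _ O (div_mem_blowupRing (x : K) hym)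

/-! ## Divisibility down the sequence -/

section Sequence

variable {O : ValuationSubring K} {R : ℕ → Subring K}
  (hstep : ∀ i, IsQuadraticTransformAlong O (R i) (R (i + 1)))
  (x : ℕ → K) (hxR : ∀ j, x j ∈ R j) (hx0 : ∀ j, x j ≠ 0) (hxv : ∀ j, O.valuation (x j) < 1)
  (hxdiv : ∀ j, ∀ y : K, y ∈ R j → O.valuation y < 1 → y / x j ∈ R (j + 1))

include hstep hxR hxv hxdiv in
/-- For `k < k'`, `x k / x k' ∈ R j` whenever `k' < j`: the later exceptional parameter divides the earlier one (`x k ∈ 𝔪_{k'}`).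
[folklore] -/
theorem div_excParam_mem {k k' j : ℕ} (hkk' : k < k') (hk'j : k' < j) : x k / x k' ∈ R j := by
  have hmono : Monotone R := sequence_monotone hstep
  have hk : x k ∈ R k' := hmono hkk'.le (hxR k)
  exact hmono (Nat.succ_le_of_lt hk'j) (hxdiv k' (x k) hk (hxv k))

include hx0 in
/-- Transitivity of «dead», in the form used for `N`-primarity: if every index in `[i, j')` is dead at some stage, then
`x j' ^ m / x i` lies in the Shannon extension for some `m`. [folklore] -/
theorem pow_div_mem_shannonExt_of_dead {i j' : ℕ} (hij' : i ≤ j')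
    (hdead : ∀ k, i ≤ k → k < j' → ∃ (j m : ℕ), x (k + 1) ^ m / x k ∈ R j) :
    ∃ m : ℕ, x j' ^ m / x i ∈ shannonExt R := by
  induction j', hij' using Nat.le_induction with
  | base => exact ⟨1, by rw [pow_one, div_self (hx0 i)]; exact Subring.one_mem _⟩
  | succ j' hij' ih =>
    obtain ⟨m₁, hm₁⟩ := ih fun k hik hkj' => hdead k hik (Nat.lt_succ_of_lt hkj')
    obtain ⟨j, m₂, hm₂⟩ := hdead j' hij' (Nat.lt_succ_self j')
    refine ⟨m₂ * m₁, ?_⟩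
    have : x (j' + 1) ^ (m₂ * m₁) / x i = (x (j' + 1) ^ m₂ / x j') ^ m₁ * (x j' ^ m₁ / x i) := by
      rw [pow_mul, div_pow]
      field_simp [hx0 j', hx0 i, pow_ne_zero m₁ (hx0 j')]
    rw [this]
    exact Subring.mul_mem _ (Subring.pow_mem _ (le_shannonExt R j hm₂) m₁) hm₁

end Sequence

/-! ## Monomial × unit presentations: divisibility is support containment -/

/-- In a regular local ring, a prime parameter `z l` divides a monomial × unit `∏ z^b · u` only if the exponent `b l` is positive.
[folklore] -/
theorem exponent_ne_zero_of_dvd {S : Subring K} [IsLocalRing S] {s : ℕ} {z : Fin s → S} (hz : IsRsopPart z)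
    (b : Fin s → ℕ) {u : S} (hu : IsUnit u) {l : Fin s} (hdvd : z l ∣ (∏ l', z l' ^ b l') * u) : b l ≠ 0 := by
  classical
  haveI := hz.isRegularLocalRing
  have hp : Prime (z l) := hz.prime l
  rcases hp.dvd_or_dvd hdvd with h | h
  · obtain ⟨l', -, hl'⟩ := hp.exists_mem_finset_dvd h
    have hzl' : z l ∣ z l' := hp.dvd_of_dvd_pow hl'
    have hll' : l = l' := by
      by_contra hne
      exact hz.not_dvd hne hzl'
    subst hll'
    intro hb
    rw [hb, pow_zero] at hl'
    exact hp.not_unit (isUnit_of_dvd_one hl')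
  · exact absurd (isUnit_of_dvd_unit h hu) hp.not_unit

/-- Divisibility inside `S` from divisibility data in `K`: if `a, c ∈ S` and `b = a · c` then `a ∣ b` in `S`. [folklore] -/
theorem dvd_of_mul_eq_mem {S : Subring K} {a b c : K} (ha : a ∈ S) (hb : b ∈ S) (hc : c ∈ S) (h : a * c = b) :
    (⟨a, ha⟩ : S) ∣ ⟨b, hb⟩ :=
  ⟨⟨c, hc⟩, Subtype.ext (by simpa using h.symm)⟩

/-- **Support containment gives divisibility of a power.** If `a = ∏ z^α · u` and `b = ∏ z^β · u'` are monomials × units on the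
same part `z` of a regular system of parameters of `S ⊆ K`, and every `z l` occurring in `a` occurs in `b` (`α l ≠ 0 → β l ≠ 0`),
then `b ^ m / a ∈ S` for `m = Σ α`. [folklore] -/
theorem pow_div_mem_of_support_subset {S : Subring K} [IsLocalRing S] {s : ℕ} {z : Fin s → S} (hz : IsRsopPart z)
    (α β : Fin s → ℕ) (u u' : S) (hu : IsUnit u) {a b : K}
    (ha : a = (∏ l, ((z l : S) : K) ^ α l) * (u : K)) (hb : b = (∏ l, ((z l : S) : K) ^ β l) * (u' : K))
    (hsupp : ∀ l, α l ≠ 0 → β l ≠ 0) :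
    ∃ m : ℕ, b ^ m / a ∈ S := by
  classical
  set m : ℕ := ∑ l, α l with hm
  refine ⟨m, ?_⟩
  -- `m · β l ≥ α l` for every `l`
  have hle : ∀ l, α l ≤ m * β l := by
    intro l
    by_cases h0 : α l = 0
    · rw [h0]; exact Nat.zero_le _
    · have hβ : 1 ≤ β l := Nat.one_le_iff_ne_zero.mpr (hsupp l h0)
      have hα : α l ≤ m := by
        rw [hm]; exact Finset.single_le_sum (fun l _ => Nat.zero_le (α l)) (Finset.mem_univ l)
      calc α l ≤ m := hα
        _ = m * 1 := (mul_one m).symm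
        _ ≤ m * β l := Nat.mul_le_mul_left m hβ
  obtain ⟨u₁, hu₁⟩ := hu
  have hUU : ((u : S) : K) * ((↑u₁⁻¹ : S) : K) = 1 := by
    rw [← hu₁, ← Subring.coe_mul, Units.mul_inv, Subring.coe_one]
  have hu0 : (u : K) ≠ 0 := left_ne_zero_of_mul_eq_one hUU
  have hz0 : ∀ l, ((z l : S) : K) ≠ 0 := fun l h0 => hz.ne_zero l (Subtype.ext h0)
  have ha0 : a ≠ 0 := by
    rw [ha]
    exact mul_ne_zero (Finset.prod_ne_zero_iff.mpr fun l _ => pow_ne_zero _ (hz0 l)) hu0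
  -- the quotient `c = ∏ z^(mβ − α) · u'^m · u⁻¹ ∈ S`
  set c : K := (∏ l, ((z l : S) : K) ^ (m * β l - α l)) * (((u' ^ m : S) : K) * ((↑u₁⁻¹ : S) : K)) with hc
  have hcS : c ∈ S := by
    refine Subring.mul_mem _ (Subring.prod_mem _ fun l _ => Subring.pow_mem _ (z l).2 _) ?_
    exact Subring.mul_mem _ (u' ^ m).2 (↑u₁⁻¹ : S).2
  have hkey : b ^ m = a * c := by
    have h1 : ∀ l, ((z l : S) : K) ^ α l * ((z l : S) : K) ^ (m * β l - α l) = ((z l : S) : K) ^ (m * β l) :=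
      fun l => by rw [← pow_add, Nat.add_sub_cancel' (hle l)]
    calc b ^ m = (∏ l, ((z l : S) : K) ^ (m * β l)) * (u' : K) ^ m := by
          rw [hb, mul_pow, ← Finset.prod_pow]
          congr 1
          exact Finset.prod_congr rfl (fun l _ => by rw [← pow_mul, mul_comm])
      _ = (∏ l, ((z l : S) : K) ^ α l * ((z l : S) : K) ^ (m * β l - α l)) *
            (((u : S) : K) * ((↑u₁⁻¹ : S) : K)) * (u' : K) ^ m := by
          rw [hUU, mul_one]
          congr 1
          exact Finset.prod_congr rfl (fun l _ => (h1 l).symm)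
      _ = a * c := by
          rw [ha, hc, Finset.prod_mul_distrib, SubmonoidClass.coe_pow]
          ring
  rw [hkey, mul_div_cancel_left₀ c ha0]
  exact hcS

/-- Conversely, if `z l` occurs in `a` but not in `b`, no power of `b` is divisible by `a` in `S`. [folklore] -/
theorem not_pow_div_mem_of_exponent {S : Subring K} [IsLocalRing S] {s : ℕ} {z : Fin s → S} (hz : IsRsopPart z)
    (α β : Fin s → ℕ) (u u' : S) (hu : IsUnit u) (hu' : IsUnit u') {a b : K}
    (ha : a = (∏ l, ((z l : S) : K) ^ α l) * (u : K)) (hb : b = (∏ l, ((z l : S) : K) ^ β l) * (u' : K))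
    {l : Fin s} (hαl : α l ≠ 0) (hβl : β l = 0) (m : ℕ) : b ^ m / a ∉ S := by
  classical
  haveI := hz.isRegularLocalRing
  intro hmem
  have hz0 : ∀ l, ((z l : S) : K) ≠ 0 := fun l h0 => hz.ne_zero l (Subtype.ext h0)
  have haS : a ∈ S := by
    rw [ha]; exact Subring.mul_mem _ (Subring.prod_mem _ fun l _ => Subring.pow_mem _ (z l).2 _) u.2
  have hbS : b ^ m ∈ S := by
    rw [hb]
    exact Subring.pow_mem _ (Subring.mul_mem _ (Subring.prod_mem _ fun l _ => Subring.pow_mem _ (z l).2 _) u'.2) m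
  obtain ⟨u₁, hu₁⟩ := hu
  have hUU : ((u : S) : K) * ((↑u₁⁻¹ : S) : K) = 1 := by
    rw [← hu₁, ← Subring.coe_mul, Units.mul_inv, Subring.coe_one]
  have hu0 : (u : K) ≠ 0 := left_ne_zero_of_mul_eq_one hUU
  have ha0 : a ≠ 0 := by
    rw [ha]
    exact mul_ne_zero (Finset.prod_ne_zero_iff.mpr fun l _ => pow_ne_zero _ (hz0 l)) hu0
  -- `a ∣ b ^ m` in `S`
  have hdvd : (⟨a, haS⟩ : S) ∣ ⟨b ^ m, hbS⟩ :=
    dvd_of_mul_eq_mem haS hbS hmem (by rw [← mul_div_assoc, mul_div_cancel_left₀ _ ha0])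
  -- `z l ∣ a` in `S` (its exponent in `a` is positive)
  have heqa : (⟨a, haS⟩ : S) = (∏ l', z l' ^ α l') * u := by
    apply Subtype.ext
    change a = _
    rw [ha]
    push_cast
    rfl
  have hzla : z l ∣ (⟨a, haS⟩ : S) := by
    rw [heqa]
    exact ((dvd_pow_self (z l) hαl).trans (Finset.dvd_prod_of_mem (fun l' => z l' ^ α l') (Finset.mem_univ l))).mul_right u
  -- hence `z l ∣ b ^ m = ∏ z^(mβ) · u'^m`, contradicting `β l = 0`
  have heqb : (⟨b ^ m, hbS⟩ : S) = (∏ l', z l' ^ (m * β l')) * u' ^ m := by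
    apply Subtype.ext
    change b ^ m = _
    push_cast
    rw [hb, mul_pow, ← Finset.prod_pow]
    congr 1
    exact Finset.prod_congr rfl (fun l _ => by rw [← pow_mul, mul_comm])
  have hzlb : z l ∣ (∏ l', z l' ^ (m * β l')) * u' ^ m := by
    rw [← heqb]
    exact hzla.trans hdvd
  have hne := exponent_ne_zero_of_dvd hz (fun l' => m * β l') (hu'.pow m) hzlb
  exact hne (by rw [hβl, mul_zero])

/-! ## The milestone: eternal indices are bounded by the number of live exceptional parameters -/

/-- **Finitely many persistent exceptional divisors (HLOST Prop. 2.8, divisibility form).** Along a sequence of quadratic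
transforms with exceptional parameters `x`, let `x 0` be a monomial × unit on an `s`-element part `z` of a regular system of
parameters of the member `R j`.  Then a finite set `F` of indices `k` with `k + 1 < j` that are NOT dead at stage `j` (no power of
`x (k+1)` is divisible by `x k` in `R j`) has at most `s` elements: each such `k` owns a parameter `z l_k` dividing `x k` but not
`x (k+1)`, and `k ↦ l_k` is injective because `x k' ∣ x (k+1)` for `k < k'`. OURS. [cite: HeinzerEtAl2015, Prop. 2.8] -/
theorem card_notDead_le {O : ValuationSubring K} {R : ℕ → Subring K}
    (hstep : ∀ i, IsQuadraticTransformAlong O (R i) (R (i + 1)))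
    (x : ℕ → K) (hxR : ∀ j, x j ∈ R j) (hx0 : ∀ j, x j ≠ 0) (hxv : ∀ j, O.valuation (x j) < 1)
    (hxdiv : ∀ j, ∀ y : K, y ∈ R j → O.valuation y < 1 → y / x j ∈ R (j + 1))
    {j : ℕ} [IsLocalRing (R j)] {s : ℕ} {z : Fin s → R j} (hz : IsRsopPart z) (e : Fin s → ℕ) (u : R j)
    (hu : IsUnit u) (hx0j : x 0 = (∏ l, ((z l : R j) : K) ^ e l) * (u : K))
    (F : Finset ℕ) (hFj : ∀ k ∈ F, k + 1 < j) (hF : ∀ k ∈ F, ∀ m : ℕ, x (k + 1) ^ m / x k ∉ R j) :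
    F.card ≤ s := by
  classical
  haveI := hz.isRegularLocalRing
  have hmono : Monotone R := sequence_monotone hstep
  -- every `x k`, `k < j`, divides `x 0` in `R j`, hence is a monomial × unit on `z`
  have hpres : ∀ k, k < j → ∃ (a : Fin s → ℕ) (w : R j), IsUnit w ∧
      x k = (∏ l, ((z l : R j) : K) ^ a l) * (w : K) := by
    intro k hk
    rcases Nat.eq_zero_or_pos k with rfl | hkpos
    · exact ⟨e, u, hu, hx0j⟩
    · have hq : x 0 / x k ∈ R j := div_excParam_mem hstep x hxR hxv hxdiv hkpos hk
      have hxk : x k ∈ R j := hmono hk.le (hxR k)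
      refine exists_monomial_of_mul_eq hz e hxk hq hu ?_
      rw [← mul_div_assoc, mul_div_cancel_left₀ _ (hx0 k)]
      exact hx0j
  choose! a w hw hxa using hpres
  -- for `k ∈ F`: a parameter occurring in `x k` but not in `x (k+1)` (recorded by its index in `ℕ`)
  have hsel : ∀ k ∈ F, ∃ l : ℕ, ∃ hl : l < s, a k ⟨l, hl⟩ ≠ 0 ∧ a (k + 1) ⟨l, hl⟩ = 0 := by
    intro k hk
    have hkj : k < j := by have := hFj k hk; omega
    have hk1 : k + 1 < j := hFj k hk
    by_contra hcon
    push Not at hcon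
    have hcon' : ∀ l : Fin s, a k l ≠ 0 → a (k + 1) l ≠ 0 := fun l hl h0 => hcon l.1 l.2 hl h0
    obtain ⟨m, hm⟩ := pow_div_mem_of_support_subset hz (a k) (a (k + 1)) (w k) (w (k + 1)) (hw k hkj)
      (hxa k hkj) (hxa (k + 1) hk1) hcon'
    exact hF k hk m hm
  choose! sel hsl hsel1 hsel2 using hsel
  -- `sel` is injective on `F`
  have hne : ∀ k ∈ F, ∀ k' ∈ F, k < k' → sel k ≠ sel k' := by
    intro k hk k' hk' hlt heq
    have hk1 : k + 1 < j := hFj k hk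
    have hk'j : k' < j := by have := hFj k' hk'; omega
    -- `x (k+1) / x k' ∈ R j`
    have hmem : x (k + 1) ^ 1 / x k' ∈ R j := by
      rw [pow_one]
      rcases Nat.lt_or_ge (k + 1) k' with h | h
      · exact div_excParam_mem hstep x hxR hxv hxdiv h hk'j
      · have : k' = k + 1 := by omega
        subst this
        rw [div_self (hx0 _)]
        exact Subring.one_mem _
    -- but `z (sel k')` occurs in `x k'` and not in `x (k+1)`
    have hfin : (⟨sel k, hsl k hk⟩ : Fin s) = ⟨sel k', hsl k' hk'⟩ := Fin.ext heq
    have h2 : a (k + 1) ⟨sel k', hsl k' hk'⟩ = 0 := by rw [← hfin]; exact hsel2 k hk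
    exact not_pow_div_mem_of_exponent hz (a k') (a (k + 1)) (w k') (w (k + 1)) (hw k' hk'j) (hw (k + 1) hk1)
      (hxa k' hk'j) (hxa (k + 1) hk1) (hsel1 k' hk') h2 1 hmem
  have hinj : Set.InjOn sel (F : Set ℕ) := by
    intro k hk k' hk' heq
    by_contra hkk'
    rcases Nat.lt_or_gt_of_ne hkk' with h | h
    · exact hne k hk k' hk' h heq
    · exact hne k' hk' k hk h heq.symm
  calc F.card ≤ (Finset.range s).card :=
        Finset.card_le_card_of_injOn sel (fun k hk => Finset.mem_coe.mpr (Finset.mem_range.mpr (hsl k hk))) hinj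
    _ = s := Finset.card_range s

/-- **At every stage, `x 0` is a monomial × unit on a part of a regular system of parameters of size `≤ dim R j`** — so the
number of not-yet-dead indices `k` with `k + 1 < j` is at most `dim R j` (`card_notDead_le`).  The monomial presentation is the
tree's `exists_monomial_along` (HLOST Lemma 2.7 iterated) from `x 0 = x 0 ^ 1 · 1` at `R 0`. OURS. [cite: HeinzerEtAl2015, Prop. 2.8] -/
theorem card_notDead_le_ringKrullDim {O : ValuationSubring K} {R : ℕ → Subring K}
    (hreg : ∀ i, IsRegularLocalRing (R i)) (hdom : ∀ i, SubringDominates (R i) O.toSubring)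
    (hstep : ∀ i, IsQuadraticTransformAlong O (R i) (R (i + 1)))
    (x : ℕ → K) (hxR : ∀ j, x j ∈ R j) (hx0 : ∀ j, x j ≠ 0) (hxv : ∀ j, O.valuation (x j) < 1)
    (hxdiv : ∀ j, ∀ y : K, y ∈ R j → O.valuation y < 1 → y / x j ∈ R (j + 1))
    (hx0rsop : IsRsopPart (fun _ : Fin 1 => (⟨x 0, hxR 0⟩ : R 0)))
    (j : ℕ) (F : Finset ℕ) (hFj : ∀ k ∈ F, k + 1 < j) (hF : ∀ k ∈ F, ∀ m : ℕ, x (k + 1) ^ m / x k ∉ R j) :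
    (F.card : WithBot ℕ∞) ≤ ringKrullDim (R j) := by
  classical
  haveI : ∀ i, IsLocalRing (R i) := fun i => inferInstance
  -- `x 0 = (x 0)^1 · 1` on the one-element part at `R 0`, transported to `R j` (HLOST Lemma 2.7 iterated)
  have hbase : ∃ (s : ℕ) (z : Fin s → R 0), IsRsopPart z ∧ ∃ (e : Fin s → ℕ) (u : R 0),
      IsUnit u ∧ x 0 = (∏ l, ((z l : R 0) : K) ^ e l) * (u : K) :=
    ⟨1, fun _ => ⟨x 0, hxR 0⟩, hx0rsop, fun _ => 1, 1, isUnit_one, by simp⟩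
  have hmon : ∃ (s : ℕ) (z : Fin s → R j), IsRsopPart z ∧ ∃ (e : Fin s → ℕ) (u : R j),
      IsUnit u ∧ x 0 = (∏ l, ((z l : R j) : K) ^ e l) * (u : K) := by
    have h := exists_monomial_along stub_rsopMonomialStep O R hstep hdom 0 (x 0) hbase j
    rwa [Nat.zero_add] at h
  obtain ⟨s, z, hz, e, u, hu, hx0j⟩ := hmon
  have hcard : F.card ≤ s := card_notDead_le hstep x hxR hx0 hxv hxdiv hz e u hu hx0j F hFj hF
  obtain ⟨-, e', -, hdim, -⟩ := hz
  rw [hdim]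
  exact_mod_cast hcard.trans (Nat.le_add_right s e')

end Summit.ResolutionOfSingularities.ResolutionOfSingularities.Theorems.SwitchingDichotomy.Hull

end
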